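import Summits.QuantumFields.BalabanUV.Beta.MultiscaleDecay
import Summits.QuantumFields.BalabanUV.Beta.CovariantBoxPoincareBlocks

/-!
# `T4Continuum.ShellMeasureCellGaugeFromPlaquettes` — (J4) THE `Beta/` ENDs' (3.35)-GAUGE DATUM `g hg ε hε hgauge hloss` SUPPLIED
# FROM IN-CELL PLAQUETTE-SMALLNESS OF THE BACKGROUND (tree transports), scale-free exactly under the `α₀·S⁻²` shape of OUR row E7
(cell `pub-balaban`, sub-cell `t4`, spine estimate NE7c (node U5b); NE7c ROUND-2 crew `t4-ne7c-formalise-*`, unit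
`b2b-balaban-t4-ne7c-formalise-leaf-01` gen 12; **ROW S119 = J4** of the owner's claim table `t4/b2b-balaban-t4-ne7c-p1/LEAVES-NE7c-P1.md`
(OFFER O-ne7cleaf01g12-1, GO by RULING R-ne7cp1-g37-8 (d), journal `CLAIMS.log`) in the owner's post-v6 ESTIMATE LANE
= the (α)-JUNCTION PROGRAMME against the existing `Beta/` multiscale library (R-ne7cp1-g37-7 (b): rows J1 normalisation ∕ J2 cube-family
data ∕ J3 E6-shape) — this file is the one binder group of THE END `MultiscaleDecay.decay_levelOp_cov` those three rows do not cover;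
ADDITIVE — imports `Beta.MultiscaleDecay` (THE END, b2b-balaban-beta-an4∕d4-p2) and `Beta.CovariantBoxPoincareBlocks` (d4-p3's (P)→(B)
defect bridge over d4-p2's `CovariantPlateauBlocks` ∕ `ThinLoopHolonomy`) ONLY, everything BY NAME; touches NO host, moves NO census
row; [folklore]; three [our object] data defs (`cellW`, `cellPlaq`, `cellGauge`), 0 `def … : Prop`, 0 sorry, 0 citation tags of ours)

HONEST FRAMING.  Finite four-torus programme, rung (B)+1 only — NOT infinite volume, NOT a mass gap, NOT the Clay problem, NOT
summit progress; (B), `BetaPertHyp`, (B^μ) not consumed and NOT discharged.  NE7c (`T4IndicatorShell.ShellWeightBound` for the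
cell's expansions) is NOT PRINTED in [Balaban 1983–89] and NOT PROVED; «NE7c ⇐ the named binders» (trigger c3).  This file is lattice
bookkeeping about the `Beta/` MODEL (pv21's torus `UT N`, cube charts `cellPt`, orthogonal bond matrices `Rm` on a real fibre `Cp` as
DATA): nothing of Bałaban's operators, minimisers or kernels is instantiated, asserted, cited or discharged.  [Balaban1985Background
Propagators] (3.19) p. 393 (contour transports), (3.35) p. 396 («there exists a gauge transformation u on □ such that … |A| <
O(1)Mα₀(L^jη)^{−1}») and [Balaban1985Averaging] (44) p. 24 (the unit plaquette) are LOCATORS of SHAPES whose `[cite:]` tags live in the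
imported `Beta/` modules; nothing printed is used as a fact (ABSOLUTE RULE).  HONEST DEPENDENCY (cell): continuum YM on T⁴ ⇐ BetaPertH ∧
nine spine estimates (0/9 proved); BetaPertH ⇐ (D1) ∧ (D4) ∧ CAP+tail; G-an2-4 gates asym, D1 and NE2/3/4.

THE POINT.  THE END the J-lane fires, `MultiscaleDecay.decay_levelOp_cov` (k-uniform decay of `(levelOp)⁻¹` for a COVARIANT
multi-region averaged operator on a disjoint covering cube family), carries — besides the cube-family data `hdisj hcover hsupp
hscale_lo∕hi` (row J2), the bond weights and the level weights — ONE field hypothesis group: an orthogonal BOX GAUGE `g k` per cell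
(`hg`) whose gauged in-cube bond variables `g_k(v)·Rm(b)·g_k(v⁺)ᵀ` are `ε_k`-close to `1` in quadratic-form shape (`hgauge`) under the
loss budget `4(dS(S−1))dε_k² + 4(d(S−1)ε_k)² ≤ θ` (`hloss`) — the (3.35)-LITERAL «a gauge exists», kept as DATA by every tree consumer
(`MultiscaleDecay(.Dirichlet)`, `MultiscaleCoerciveTorusCov`, `MultiscaleCoerciveCover`).  OUR row E7 of THE ONE CALL (`h52locw`∕
`h52loce`: `pdevOn (box) (Ubg V) < α₀·((L^k)⁻¹)²`) is PLAQUETTE-smallness on boxes, not «a gauge exists» (leaf-05-g12's MAP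
`HOME/t4/…/leaf-05/g12/ALPHA-IN-TREE-MAP.md` (D6): «the axial-gauge lemma is the ONE analytic step between E7 as typed and `hgauge`
as typed»).  Everything needed is in the tree on d4-p2∕d4-p3's FIBRED BLOCK CARRIER (`CovariantPlateauBlocks`: blocks `Y` × offsets
`(Fin n)^ν`): the B5 (1.7) tree transports `Rtr`, the thin-loop defect `hdef`, **`hdef_le_of_plaqW`** (`hdef ≤ ν(n−1)·α` from the
in-block plaquettes — b07's non-abelian Stokes ladder via `ThinLoopHolonomy`) and **`CovariantBoxPoincareBlocks.hHol_of_le`** (part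
(B)'s quadratic-form defect hypothesis — the SAME Lean shape as `hgauge` — with `T := Rtr`).  THIS FILE is the last mile to THE END's
TORUS-CELL carrier:
* §1 cell `k` of the END's family read as a ONE-BLOCK fibred carrier `cellW k : Bond Unit d (S_k) → Matrix Cp Cp ℝ`
  (`b ↦ Rm (cellPt k v, i)`), orthogonal by `hRm` (`cellW_orth`); the in-cell plaquette `cellPlaq k v κ μ` (chart form) and THE
  DESIGNED GAUGE **`cellGauge k v := Rtr (cellW k) ((), v)`** with THE END's `hg` (`cellGauge_orth`);
* §2 **`hol_cell_eq`**: THE END's gauged bond variable `hol Rm (cellGauge k) (v i ↦ (cellPt k v, i))` IS d4-p2's box holonomy on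
  the one-block carrier — `rfl` (`Box = Off`, `succ = succOff`); `plaqW (cellW k) () = cellPlaq k` (`rfl`) and its TORUS spelling
  `Rm(x,κ)·Rm(x+e_κ,μ)·Rm(x+e_μ,κ)ᵀ·Rm(x,μ)ᵀ`, `x = cellPt k v` (`cellPlaq_eq_torus`, by `up_cubePt`);
* §3 **`hgauge_of_hdef`** (THE END's `hgauge k` VERBATIM from any bound on `hdef` over the cell's in-box bonds) and
  **`hgauge_of_plaquettes`**: `hgauge k` with **`ε_k := d·(S_k − 1)·α_k`** from «every in-cell plaquette of `Rm` is within `α_k` of `1`»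
  (`ℓ²`-operator norm of the complexification, `cpxHom`, as in the `Beta/` files; `[Nonempty Cp]`);
* §4 **`hloss_of_plaquettes`**: `4(dS(S−1))dε² + 4(d(S−1)ε)² = 4d⁴α²(S−1)³(2S−1) ≤ 8d⁴(S²α)²`, so under **`S_k²·α_k ≤ α₀`** the budget
  is met by **`θ := 8d⁴α₀²`** — level-, side-, volume-free: scale-free EXACTLY when the plaquette bound has E7's shape `α₀·S⁻²`;
* §5 THE END FIRED: **`decay_levelOp_cov_of_plaquettes`** = `decay_levelOp_cov` BY NAME with `(g, hg, ε, hε, hgauge, hloss)` SUPPLIED;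
  remaining hypotheses = J2's cube-family data + `hRm` + weights∕sizes + `hplaq`, `0 ≤ α_k`, `S_k²α_k ≤ α₀` + the rate `κ` and
  `hμ` at `θ = 8d⁴α₀²`; conclusion token-identical to THE END's at that `θ`;
* §6 non-vacuity (crew rule G-1): the entering rows `hplaq`∕`hα`∕`hαS` jointly inhabited on a one-cell d = 2 torus by (a) the flat
  field and (b) a NON-trivial commuting rotation field (plaquettes `= 1`, tree gauge `≠ 1`), `hgauge_of_plaquettes` and
  `hloss_of_plaquettes` FIRED there; and `hμ`'s budget factor `1 − 8d⁴α₀² > 0` at `d = 4`, `α₀ = 1∕64`.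
WHAT THIS FILE DOES NOT DO.  It does not say WHICH `Rm` (node O; the adjoint-carrier step for a `U(N)`-valued background —
`AdjointCarrierWiringEnd.Wad` ∕ `hplaqW_Wad_of_plaq`, factor 2 — is wired BY NAME in the sequel file `ShellMeasureCellGaugeFromPlaquettesAd`,
not here), WHICH cells (J2), nor the normalisation (J1); E7 stays a displayed [T] row of THE ONE CALL of record; the census COUNT does
not move.  It only makes the (α1)∕(α2)
ENDs' field hypothesis READ «plaquette-small on the cells» — E7's species — instead of «a gauge exists».  NOTHING in the countdown
moves; NE7c NOT PROVED; spine PROVED 0∕9.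
-/

noncomputable section

open scoped BigOperators Matrix Matrix.Norms.L2Operator
open Finset Function

namespace Summit.QuantumFields.BalabanUV.T4Continuum.ShellMeasureCellGaugeFromPlaquettes

open Summit.QuantumFields.BalabanUV.Beta
open Summit.QuantumFields.BalabanUV.Beta.BoxPoincare (Box)
open Summit.QuantumFields.BalabanUV.Beta.CovariantBoxPoincare (hol succ)
open Summit.QuantumFields.BalabanUV.Beta.MultiscaleCoerciveTorus
open Summit.QuantumFields.BalabanUV.Beta.MultiscaleDistance
open Summit.QuantumFields.BalabanUV.Beta.MultiscaleDecayBudget (siteScale)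
open Summit.QuantumFields.BalabanUV.Beta.MultiscaleDecay (decay_levelOp_cov)
open Summit.QuantumFields.BalabanUV.Beta.ThinLoopHolonomy (cpxHom)
open Summit.QuantumFields.BalabanUV.Beta.CovariantPlateauBlocks (Off BSite Bond Rtr hdef plaqW succOff hdef_le_of_plaqW
  transpose_mul_Rtr)
open Summit.QuantumFields.BalabanUV.Beta.CovariantBoxPoincareBlocks (hHol_of_le Rtr_cols_orthonormal)
open Literature.MathematicalPhysics.QuantumFieldTheory.Balaban1983to89
open Literature.MathematicalPhysics.QuantumFieldTheory.Balaban1983to89.B9Thm37GluePU (bsrc btgt)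
open Literature.MathematicalPhysics.QuantumFieldTheory.Balaban1983to89.B9Thm37GlueTorusCov (tblk torusComb)
open Literature.MathematicalPhysics.QuantumFieldTheory.Balaban1983to89.B9Thm37GlueTorusCovLevels (levelOp)
open Literature.MathematicalPhysics.QuantumFieldTheory.Balaban1983to89.B5Leibniz121 (up)
open B5TorusCover (UT Ctr ctrU)

variable {d : ℕ} {N : Fin d → ℕ} [∀ i, NeZero (N i)] {Cp J K : Type} [Fintype Cp] [DecidableEq Cp]
  (S : J → ℕ) (hS : ∀ l, 1 ≤ S l) (hdivS : ∀ l i, S l ∣ N i) (lvl : K → J) (zc : (k : K) → Ctr N (S (lvl k)))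
  (Rm : UT N × Fin d → Cp → Cp → ℝ)

/-! ## §1 One cell read as a one-block fibred carrier; the designed tree gauge -/

include hS in
/-- A cell side is nonzero. [folklore] -/
theorem neZero_side (k : K) : NeZero (S (lvl k)) := ⟨by have := hS (lvl k); omega⟩

/-- **[our object] CELL `k`'s BOND MATRICES READ ON THE ONE-BLOCK FIBRED CARRIER** `Bond Unit d (S (lvl k))` of
`CovariantPlateauBlocks`: the bond from offset `v` in direction `i` carries `Rm (cellPt k v, i)`. [folklore] -/
def cellW (k : K) : Bond Unit d (S (lvl k)) → Matrix Cp Cp ℝ :=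
  fun b => Matrix.of (Rm (cellPt S hS hdivS lvl zc k b.1.2, b.2))

omit [Fintype Cp] [DecidableEq Cp] in
/-- Entries of `cellW`. [folklore] -/
@[simp] theorem cellW_apply (k : K) (v : Off d (S (lvl k))) (i : Fin d) (a j : Cp) :
    cellW S hS hdivS lvl zc Rm k (((), v), i) a j = Rm (cellPt S hS hdivS lvl zc k v, i) a j := rfl

/-- `cellW` is orthogonal: `(W b)ᵀ·W b = 1` — the END's `hRm` re-spelled. [folklore] -/
theorem cellW_orth (hRm : ∀ b i j, ∑ k, Rm b k i * Rm b k j = if i = j then (1 : ℝ) else 0) (k : K) :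
    ∀ b, (cellW S hS hdivS lvl zc Rm k b)ᵀ * cellW S hS hdivS lvl zc Rm k b = 1 := by
  intro b
  ext i j
  rw [Matrix.mul_apply, Matrix.one_apply]
  exact hRm _ i j

/-- **[our object] THE IN-CELL PLAQUETTE of `Rm`** based at the chart point `x = cellPt k v` in the directions `κ, μ` (both
successors inside the cell): `Rm(x,κ)·Rm(x+e_κ,μ)·Rm(x+e_μ,κ)ᵀ·Rm(x,μ)ᵀ` (chart form; `= plaqW (cellW k) () v κ μ`, §2). [folklore] -/
def cellPlaq (k : K) (v : Box d (S (lvl k))) (κ μ : Fin d) (hκ : (v κ : ℕ) + 1 < S (lvl k))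
    (hμ : (v μ : ℕ) + 1 < S (lvl k)) : Matrix Cp Cp ℝ :=
  Matrix.of (Rm (cellPt S hS hdivS lvl zc k v, κ)) * Matrix.of (Rm (cellPt S hS hdivS lvl zc k (succ v κ hκ), μ)) *
    (Matrix.of (Rm (cellPt S hS hdivS lvl zc k (succ v μ hμ), κ)))ᵀ * (Matrix.of (Rm (cellPt S hS hdivS lvl zc k v, μ)))ᵀ

/-- **[our object] THE DESIGNED GAUGE OF CELL `k`** — the B5 (1.7) TREE TRANSPORT `Rtr` of `CovariantPlateauBlocks` for the cell's
bond matrices: `g_k(v) = Rm(Γ_{corner, v})` along the corner tree of the box (needs the orthogonality `hRm`). [folklore] -/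
def cellGauge (hRm : ∀ b i j, ∑ k, Rm b k i * Rm b k j = if i = j then (1 : ℝ) else 0) (k : K)
    (v : Box d (S (lvl k))) : Cp → Cp → ℝ :=
  haveI := neZero_side S hS lvl k
  (Rtr (cellW S hS hdivS lvl zc Rm k) (cellW_orth S hS hdivS lvl zc Rm hRm k) ((), v) : Matrix Cp Cp ℝ)

variable (hRm : ∀ b i j, ∑ k, Rm b k i * Rm b k j = if i = j then (1 : ℝ) else 0)

/-- **THE END's `hg`**: the designed gauge has orthonormal columns. [folklore] -/
theorem cellGauge_orth (k : K) (v : Box d (S (lvl k))) (i i' : Cp) :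
    ∑ k', cellGauge S hS hdivS lvl zc Rm hRm k v k' i * cellGauge S hS hdivS lvl zc Rm hRm k v k' i' =
      if i = i' then (1 : ℝ) else 0 := by
  haveI := neZero_side S hS lvl k
  exact Rtr_cols_orthonormal (cellW S hS hdivS lvl zc Rm k) (cellW_orth S hS hdivS lvl zc Rm hRm k) ((), v) i i'

/-! ## §2 The END's gauged in-cube bond variable IS d4-p2's box holonomy on the one-block carrier -/

/-- **THE TWO HOLONOMIES AGREE** (definitional: both read `Rm (cellPt k v, i)` between `g_k(v)` and `g_k(v + e_i)ᵀ`;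
`Box = Off`, `succ = succOff` by `rfl`). [folklore] -/
theorem hol_cell_eq (k : K) (v : Box d (S (lvl k))) (i : Fin d) (hv : (v i : ℕ) + 1 < S (lvl k)) (a j : Cp) :
    hol Rm (cellGauge S hS hdivS lvl zc Rm hRm k) (fun v i _ => (cellPt S hS hdivS lvl zc k v, i)) v i hv a j =
      haveI := neZero_side S hS lvl k
      hol (fun b : Bond Unit d (S (lvl k)) => (cellW S hS hdivS lvl zc Rm k b : Cp → Cp → ℝ))
        (fun v : Box d (S (lvl k)) =>
          (Rtr (cellW S hS hdivS lvl zc Rm k) (cellW_orth S hS hdivS lvl zc Rm hRm k) ((), v) : Cp → Cp → ℝ))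
        (fun (v : Box d (S (lvl k))) (i : Fin d) (_ : (v i : ℕ) + 1 < S (lvl k)) =>
          ((((), v), i) : Bond Unit d (S (lvl k))))
        v i hv a j := rfl

omit [DecidableEq Cp] in
/-- The chart plaquette IS `plaqW` of the one-block carrier. [folklore] -/
theorem plaqW_cellW (k : K) (v : Box d (S (lvl k))) (κ μ : Fin d) (hκ : (v κ : ℕ) + 1 < S (lvl k))
    (hμ : (v μ : ℕ) + 1 < S (lvl k)) :
    haveI := neZero_side S hS lvl k
    plaqW (cellW S hS hdivS lvl zc Rm k) () v κ μ hκ hμ = cellPlaq S hS hdivS lvl zc Rm k v κ μ hκ hμ :=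
  rfl

omit [DecidableEq Cp] in
/-- The in-cell plaquette in TORUS form (`up_cubePt`: the in-cube successor is the torus shift `up`). [folklore] -/
theorem cellPlaq_eq_torus (k : K) (v : Box d (S (lvl k))) (κ μ : Fin d) (hκ : (v κ : ℕ) + 1 < S (lvl k))
    (hμ : (v μ : ℕ) + 1 < S (lvl k)) :
    cellPlaq S hS hdivS lvl zc Rm k v κ μ hκ hμ =
      Matrix.of (Rm (cellPt S hS hdivS lvl zc k v, κ)) * Matrix.of (Rm (up (cellPt S hS hdivS lvl zc k v) κ, μ)) *
        (Matrix.of (Rm (up (cellPt S hS hdivS lvl zc k v) μ, κ)))ᵀ * (Matrix.of (Rm (cellPt S hS hdivS lvl zc k v, μ)))ᵀ := by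
  simp only [cellPlaq, cellPt]
  rw [up_cubePt _ _ _ _ _ hκ, up_cubePt _ _ _ _ _ hμ]

/-! ## §3 `hgauge` from the thin-loop defect, hence from the in-cell plaquettes -/

/-- **THE END's `hgauge k` FROM ANY BOUND ON THE THIN-LOOP DEFECT** of the cell's in-box bonds (`CovariantPlateauBlocks.hdef`,
the `ℓ²`-operator norm of the complexified `Hol − 1`; `CovariantBoxPoincareBlocks.hHol_of_le` BY NAME through §2). [folklore] -/
theorem hgauge_of_hdef (k : K) {ε : ℝ}
    (hh : haveI := neZero_side S hS lvl k
      ∀ (v : Off d (S (lvl k))) (i : Fin d), (v i : ℕ) + 1 < S (lvl k) →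
        hdef (cellW S hS hdivS lvl zc Rm k) (cellW_orth S hS hdivS lvl zc Rm hRm k) (fun _ _ => ())
          ((((), v), i) : Bond Unit d (S (lvl k))) () ≤ ε)
    (v : Box d (S (lvl k))) (i : Fin d) (hv : (v i : ℕ) + 1 < S (lvl k)) (u : Cp → ℝ) :
    ∑ a', (∑ j, (hol Rm (cellGauge S hS hdivS lvl zc Rm hRm k) (fun v i _ => (cellPt S hS hdivS lvl zc k v, i)) v i hv a' j -
        if a' = j then 1 else 0) * u j) ^ 2 ≤ ε ^ 2 * ∑ j, u j ^ 2 := by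
  haveI := neZero_side S hS lvl k
  exact hHol_of_le (cellW S hS hdivS lvl zc Rm k) (cellW_orth S hS hdivS lvl zc Rm hRm k) (fun _ _ => ()) () hh v i hv u

/-- **THE END's `hgauge k` FROM THE IN-CELL PLAQUETTES**: if every plaquette of `Rm` inside cell `k` is within `α` of `1`
(`ℓ²`-operator norm of the complexification), the designed gauge's in-cube bond variables are `d·(S_k − 1)·α`-close to `1` in the
END's quadratic-form shape (`CovariantPlateauBlocks.hdef_le_of_plaqW` — b07's non-abelian Stokes ladder — then `hgauge_of_hdef`).
[folklore] -/
theorem hgauge_of_plaquettes [Nonempty Cp] (k : K) {α : ℝ} (hα : 0 ≤ α)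
    (hplaq : ∀ (v : Box d (S (lvl k))) (κ μ : Fin d) (hκ : (v κ : ℕ) + 1 < S (lvl k)) (hμ : (v μ : ℕ) + 1 < S (lvl k)),
      κ ≠ μ → ‖cpxHom (cellPlaq S hS hdivS lvl zc Rm k v κ μ hκ hμ) - 1‖ ≤ α)
    (v : Box d (S (lvl k))) (i : Fin d) (hv : (v i : ℕ) + 1 < S (lvl k)) (u : Cp → ℝ) :
    ∑ a', (∑ j, (hol Rm (cellGauge S hS hdivS lvl zc Rm hRm k) (fun v i _ => (cellPt S hS hdivS lvl zc k v, i)) v i hv a' j -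
        if a' = j then 1 else 0) * u j) ^ 2 ≤ (d * ((S (lvl k) : ℝ) - 1) * α) ^ 2 * ∑ j, u j ^ 2 := by
  haveI := neZero_side S hS lvl k
  refine hgauge_of_hdef S hS hdivS lvl zc Rm hRm k (fun v i hv => ?_) v i hv u
  exact hdef_le_of_plaqW (cellW S hS hdivS lvl zc Rm k) (cellW_orth S hS hdivS lvl zc Rm hRm k) (fun _ _ => ()) hα
    (fun _ v κ μ hκ hμ hκμ => hplaq v κ μ hκ hμ hκμ) (b := ((((), v), i) : Bond Unit d (S (lvl k)))) hv ()

/-! ## §4 The loss budget is scale-free exactly under the `α₀·S⁻²` shape -/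

omit [∀ i, NeZero (N i)] [Fintype Cp] [DecidableEq Cp] in
/-- Arithmetic: with `ε = d(s−1)α`, `4(ds(s−1))dε² + 4(d(s−1)ε)² = 4d⁴α²(s−1)³(2s−1) ≤ 8d⁴(s²α)² ≤ 8d⁴α₀²` when `1 ≤ s`, `0 ≤ α`,
`s²α ≤ α₀`. [folklore] -/
theorem loss_arith {dd s α α₀ : ℝ} (hs : 1 ≤ s) (hα : 0 ≤ α) (hαS : s ^ 2 * α ≤ α₀) :
    4 * (dd * s * (s - 1)) * dd * (dd * (s - 1) * α) ^ 2 + 4 * (dd * (s - 1) * (dd * (s - 1) * α)) ^ 2 ≤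
      8 * dd ^ 4 * α₀ ^ 2 := by
  have ht : 0 ≤ s - 1 := by linarith
  have hts : s - 1 ≤ s := by linarith
  have h1 : (s - 1) ^ 3 ≤ s ^ 3 := by gcongr
  have h2 : (s - 1) ^ 4 ≤ s ^ 4 := by gcongr
  have hsq : (s ^ 2 * α) ^ 2 ≤ α₀ ^ 2 := by
    have : 0 ≤ s ^ 2 * α := by positivity
    gcongr
  have hd4 : 0 ≤ dd ^ 4 := by positivity
  have hs0 : 0 ≤ s := by linarith
  calc 4 * (dd * s * (s - 1)) * dd * (dd * (s - 1) * α) ^ 2 + 4 * (dd * (s - 1) * (dd * (s - 1) * α)) ^ 2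
      = 4 * dd ^ 4 * α ^ 2 * (s * (s - 1) ^ 3) + 4 * dd ^ 4 * α ^ 2 * (s - 1) ^ 4 := by ring
    _ ≤ 4 * dd ^ 4 * α ^ 2 * (s * s ^ 3) + 4 * dd ^ 4 * α ^ 2 * s ^ 4 := by gcongr
    _ = 8 * dd ^ 4 * (s ^ 2 * α) ^ 2 := by ring
    _ ≤ 8 * dd ^ 4 * α₀ ^ 2 := by gcongr

omit [∀ i, NeZero (N i)] [Fintype Cp] [DecidableEq Cp] in
include hS in
/-- **THE END's `hloss` AT `θ := 8d⁴α₀²`** for `ε_k = d(S_k − 1)α_k` whenever `S_k²·α_k ≤ α₀` — level-, side- and volume-free;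
i.e. scale-free EXACTLY when the plaquette bound has the `α₀·S⁻²` shape. [folklore] -/
theorem hloss_of_plaquettes (α : K → ℝ) (hα : ∀ k, 0 ≤ α k) {α₀ : ℝ}
    (hαS : ∀ k, (S (lvl k) : ℝ) ^ 2 * α k ≤ α₀) (k : K) :
    4 * ((d : ℝ) * (S (lvl k)) * ((S (lvl k) : ℝ) - 1)) * d * (d * ((S (lvl k) : ℝ) - 1) * α k) ^ 2 +
        4 * ((d * (S (lvl k) - 1) : ℕ) * (d * ((S (lvl k) : ℝ) - 1) * α k)) ^ 2 ≤ 8 * (d : ℝ) ^ 4 * α₀ ^ 2 := by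
  have hs : (1 : ℝ) ≤ S (lvl k) := by exact_mod_cast hS (lvl k)
  have hcast : ((d * (S (lvl k) - 1) : ℕ) : ℝ) = d * ((S (lvl k) : ℝ) - 1) := by
    rw [Nat.cast_mul, Nat.cast_sub (hS (lvl k)), Nat.cast_one]
  rw [hcast]
  exact loss_arith hs (hα k) (hαS k)

/-! ## §5 THE END FIRED: `decay_levelOp_cov` with the gauge datum SUPPLIED -/

include hRm in
/-- **k-UNIFORM DECAY FOR A PLAQUETTE-SMALL COVARIANT BACKGROUND (MODEL; `MultiscaleDecay.decay_levelOp_cov` BY NAME with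
`g := cellGauge`, `hg := cellGauge_orth`, `ε_k := d(S_k−1)α_k`, `hε`, `hgauge` (§3), `hloss` (§4) SUPPLIED).**  Remaining
hypotheses: the cube-family data (`hdisj hcover hsupp hscale_lo∕hi` — row J2's), `hRm`, the weights∕sizes, and — in place of
«a gauge exists» — «every in-cell plaquette of `Rm` is within `α_k` of `1` with `S_k²·α_k ≤ α₀`»; `θ = 8d⁴α₀²`. Conclusion
token-identical to the END's at that `θ`. [folklore] -/
theorem decay_levelOp_cov_of_plaquettes [NeZero d] [Fintype J] [Fintype K] [Nonempty Cp]
    (hdisj : ∀ k k' v v', cellPt S hS hdivS lvl zc k v = cellPt S hS hdivS lvl zc k' v' → k = k')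
    (hcover : ∀ x : UT N, ∃ k, ∃ v : Box d (S (lvl k)), cellPt S hS hdivS lvl zc k v = x)
    (a : J → ℝ) (ha : ∀ j, 0 ≤ a j) (ω : J → UT N → ℝ)
    (hsupp : ∀ l x, ω l (ctrU N (S l) (tblk (hS l) (hdivS l) x)) ≠ 0 → ∃ k v, lvl k = l ∧ cellPt S hS hdivS lvl zc k v = x)
    {amin amax : ℝ} (hamin : 0 ≤ amin) (hamax : 0 ≤ amax)
    (hscale_lo : ∀ k, amin / (S (lvl k) : ℝ) ^ 2 ≤ a (lvl k) * ω (lvl k) (ctrU N (S (lvl k)) (zc k)) ^ 2 * (S (lvl k) : ℝ) ^ d)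
    (hscale_hi : ∀ k, a (lvl k) * ω (lvl k) (ctrU N (S (lvl k)) (zc k)) ^ 2 * (S (lvl k) : ℝ) ^ d ≤ amax / (S (lvl k) : ℝ) ^ 2)
    (c : UT N × Fin d → ℝ) {cmin cmax : ℝ} (hcmin : 0 < cmin) (hc_lo : ∀ b, cmin ≤ |c b|) (hc_hi : ∀ b, |c b| ≤ cmax)
    (α : K → ℝ) (hα : ∀ k, 0 ≤ α k) {α₀ : ℝ} (hαS : ∀ k, (S (lvl k) : ℝ) ^ 2 * α k ≤ α₀)
    (hplaq : ∀ k (v : Box d (S (lvl k))) (κ μ : Fin d) (hκ : (v κ : ℕ) + 1 < S (lvl k)) (hμ : (v μ : ℕ) + 1 < S (lvl k)),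
      κ ≠ μ → ‖cpxHom (cellPlaq S hS hdivS lvl zc Rm k v κ μ hκ hμ) - 1‖ ≤ α k)
    {κ : ℝ} (hκ0 : 0 ≤ κ) (hκ1 : κ ≤ 1)
    (hμ : 0 < (1 - 8 * (d : ℝ) ^ 4 * α₀ ^ 2) * min (cmin ^ 2 / (4 * d)) (amin / 4) - 2 * d * cmax ^ 2 * κ ^ 2 -
      amax * (Real.exp (2 * d * κ) - 1))
    (p q : UT N × Cp) :
    IsUnit (levelOp bsrc btgt c Rm (fun l x => ctrU N (S l) (tblk (hS l) (hdivS l) x))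
        (fun l x => ω l (ctrU N (S l) (tblk (hS l) (hdivS l) x))) (fun l x => (torusComb (hS l) (hdivS l)).tr Rm x) a) ∧
      |Ring.inverse (levelOp bsrc btgt c Rm (fun l x => ctrU N (S l) (tblk (hS l) (hdivS l) x))
          (fun l x => ω l (ctrU N (S l) (tblk (hS l) (hdivS l) x))) (fun l x => (torusComb (hS l) (hdivS l)).tr Rm x) a)
          (Pi.single q 1) p| ≤
        Real.exp (-(κ * sdist bsrc btgt (siteScale S hS hdivS lvl zc hcover) p.1 q.1)) *
          ((siteScale S hS hdivS lvl zc hcover p.1 : ℝ) * (siteScale S hS hdivS lvl zc hcover q.1 : ℝ)) /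
          ((1 - 8 * (d : ℝ) ^ 4 * α₀ ^ 2) * min (cmin ^ 2 / (4 * d)) (amin / 4) - 2 * d * cmax ^ 2 * κ ^ 2 -
            amax * (Real.exp (2 * d * κ) - 1)) :=
  decay_levelOp_cov S hS hdivS lvl zc hdisj hcover Rm hRm a ha ω hsupp hamin hamax hscale_lo hscale_hi c hcmin hc_lo hc_hi
    (cellGauge S hS hdivS lvl zc Rm hRm) (cellGauge_orth S hS hdivS lvl zc Rm hRm)
    (fun k => d * ((S (lvl k) : ℝ) - 1) * α k)
    (fun k => by
      have hs : (1 : ℝ) ≤ S (lvl k) := by exact_mod_cast hS (lvl k)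
      have := hα k
      have : (0 : ℝ) ≤ (S (lvl k) : ℝ) - 1 := by linarith
      positivity)
    (fun k v i hv u => hgauge_of_plaquettes S hS hdivS lvl zc Rm hRm k (hα k) (hplaq k) v i hv u)
    (fun k => hloss_of_plaquettes S hS lvl α hα hαS k) hκ0 hκ1 hμ p q

/-! ## §6 Non-vacuity (crew rule G-1): the entering rows jointly inhabited, THE END's gauge rows FIRED -/

section NonVacuity

/-- The quarter-turn `R = [[0, −1], [1, 0]]` of the fibre `ℝ²` as a bond matrix (the same on every bond). [folklore] -/
private def rot : Fin 2 → Fin 2 → ℝ := fun i j => if i = j then 0 else if i = 0 then -1 else 1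

/-- `Rᵀ·R = 1` in the END's column form. [folklore] -/
private theorem rot_orth (i j : Fin 2) : ∑ k, rot k i * rot k j = if i = j then (1 : ℝ) else 0 := by
  fin_cases i <;> fin_cases j <;> simp [rot, Fin.sum_univ_two]

/-- `R·R·Rᵀ·Rᵀ = 1`: the plaquettes of the constant rotation field are trivial (although `R ≠ 1`). [folklore] -/
private theorem rot_plaq :
    Matrix.of rot * Matrix.of rot * (Matrix.of rot)ᵀ * (Matrix.of rot)ᵀ = (1 : Matrix (Fin 2) (Fin 2) ℝ) := by
  ext i j
  fin_cases i <;> fin_cases j <;>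
    simp [rot, Matrix.mul_apply, Fin.sum_univ_two, Matrix.transpose_apply]

/-- (b) A NON-trivial background with trivial plaquettes: on the one-cell scheme with `Rm ≡ R` (quarter-turn), the entering rows
hold with `α = 0 ≤ α₀ = 0` (`hplaq` by `rot_plaq`, `hα`, `hαS`), and THE END's `hgauge`∕`hloss` rows FIRE through
`hgauge_of_plaquettes`∕`hloss_of_plaquettes` (ε = 2·1·0, θ = 0). [folklore] -/
example (v : Box 2 2) (i : Fin 2) (hv : (v i : ℕ) + 1 < 2) (u : Fin 2 → ℝ) :
    (∑ a', (∑ j, (hol (fun _ : UT (fun _ : Fin 2 => 2) × Fin 2 => rot)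
        (cellGauge (fun _ : Unit => 2) (fun _ => one_le_two) (fun _ _ => dvd_rfl) (fun _ : Unit => ()) (fun _ _ => ⟨0, B5TorusCover.one_le_nC _ _⟩)
          (fun _ => rot) (fun _ => rot_orth) ())
        (fun v i _ => (cellPt (fun _ : Unit => 2) (fun _ => one_le_two) (fun _ _ => dvd_rfl) (fun _ : Unit => ()) (fun _ _ => ⟨0, B5TorusCover.one_le_nC _ _⟩)
          () v, i)) v i hv a' j - if a' = j then 1 else 0) * u j) ^ 2 ≤ ((2 : ℕ) * (((2 : ℕ) : ℝ) - 1) * 0) ^ 2 * ∑ j, u j ^ 2) ∧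
    (4 * (((2 : ℕ) : ℝ) * ((2 : ℕ)) * ((((2 : ℕ)) : ℝ) - 1)) * (2 : ℕ) * ((2 : ℕ) * ((((2 : ℕ)) : ℝ) - 1) * 0) ^ 2 +
        4 * (((2 * (2 - 1) : ℕ)) * ((2 : ℕ) * ((((2 : ℕ)) : ℝ) - 1) * 0)) ^ 2 ≤ 8 * ((2 : ℕ) : ℝ) ^ 4 * (0 : ℝ) ^ 2) := by
  refine ⟨hgauge_of_plaquettes (fun _ : Unit => 2) (fun _ => one_le_two) (fun _ _ => dvd_rfl) (fun _ : Unit => ()) (fun _ _ => ⟨0, B5TorusCover.one_le_nC _ _⟩)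
      (fun _ => rot) (fun _ => rot_orth) () le_rfl (fun v κ μ hκ hμ _ => ?_) v i hv u,
    hloss_of_plaquettes (K := Unit) (fun _ : Unit => 2) (fun _ => one_le_two) (fun _ : Unit => ()) (fun _ => 0) (fun _ => le_rfl)
      (α₀ := 0) (fun _ => by norm_num) ()⟩
  rw [cellPlaq, rot_plaq, map_one, sub_self, norm_zero]

/-- (a) The flat field `Rm ≡ 1` on the same scheme: `hplaq` with `α = 0` (plaquettes `1·1·1ᵀ·1ᵀ = 1`). [folklore] -/
example (v : Box 2 2) (κ μ : Fin 2) (hκ : (v κ : ℕ) + 1 < 2) (hμ : (v μ : ℕ) + 1 < 2) :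
    ‖cpxHom (cellPlaq (Cp := Fin 2) (fun _ : Unit => 2) (fun _ => one_le_two) (fun _ _ => dvd_rfl) (fun _ : Unit => ())
      (fun _ _ => ⟨0, B5TorusCover.one_le_nC _ _⟩) (fun _ : UT (fun _ : Fin 2 => 2) × Fin 2 => (oneM : Fin 2 → Fin 2 → ℝ)) () v κ μ hκ hμ) - 1‖ ≤ 0 := by
  have h1 : (Matrix.of (oneM : Fin 2 → Fin 2 → ℝ)) = 1 := by
    ext i j; simp [oneM, Matrix.one_apply]
  rw [cellPlaq, h1, Matrix.transpose_one, mul_one, mul_one, mul_one, map_one, sub_self, norm_zero]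

/-- The budget factor of `hμ` at `θ = 8d⁴α₀²` is live: at `d = 4`, `α₀ = 1∕64`, `1 − 8·4⁴·(1∕64)² = 1∕2 > 0`. [folklore] -/
example : (0 : ℝ) < 1 - 8 * (4 : ℝ) ^ 4 * (1 / 64) ^ 2 := by norm_num

end NonVacuity

end Summit.QuantumFields.BalabanUV.T4Continuum.ShellMeasureCellGaugeFromPlaquettes

end
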